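import Summits.ResolutionOfSingularities.ResolutionOfSingularities.Theorems.EquisingularLiftEquisingularLiftSectionKer
import Summits.ResolutionOfSingularities.ResolutionOfSingularities.Theorems.EquisingularLiftEquisingularLiftSplit
import Literature.AlgebraicGeometry.Resolution.Blowups
import HarnessLib

/-!
# [OURS · L1 W4.5(b)] EL♮ `EquisingularLiftNat` (stmt-ResolutionOfSingularities-20038), line `sections` — SECTION TOOLKIT (E1):
# Hensel sections are E1-admissible centres; E1-chains forget to chains; E1-chains compose

Helper file `--supports stmt-ResolutionOfSingularities-20038` for the FIRST RUNG `stub_elnat_le_two` of the skeleton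
`SkeletonELnat-v1` (planner res-L1-w45b-plan-1; CRUX-PLAN v3 §2/§4 «T_sec», PORT-MAP-le_two Step 3). NOT a statement of any
manuscript; OURS plumbing only.

The item `EquisingularLiftNat` differs from `EquisingularLift` (stmt-15660) in its inductive clause by ONE extra step
hypothesis **E1**: for a step `X'' = Bl_C X' → X'` of the tower over the base `q : P → Spec O`,
`(C.support : Set X') ∩ (σ' ≫ q) ⁻¹' {closed point} ⊆ Y'` — the special points of the centre lie in the current strict
transform `Y'`. When the centre is (the kernel ideal sheaf of) a SECTION `s : Spec O → X'` of `σ' ≫ q`, its support is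
`s(Spec O)`, which meets the special fibre in the single point `s(s₀)`; so E1 holds as soon as `s(s₀) ∈ Y'`, which is the
case for the Hensel sections through singular points of `Y'` used by the first rung. This file records, for a GENERAL base
`q : P → Spec O` (instantiate `P := Proj (MvPolynomial.homogeneousSubmodule (Fin (n+1)) O)`,
`q := Proj.toSpecZero _ ≫ Spec.map (CommRingCat.ofHom (algebraMap O (_ 0)))` to get the item's clause syntactically):

* `range_inter_preimage_closedPoint_of_section` — `range s ∩ r⁻¹{s₀} = {s s₀}` for a section `s` of `r : X → Spec O`;
* `support_ker_inter_preimage_closedPoint_of_section` — the same for the support of `ker s` (`O` a DVR, `r` separated: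
  `supp (ker s) = range s`, tree `section_isClosedImmersion_and_isRegular_ker` p167199), and the E1 corollary
  `support_ker_inter_preimage_closedPoint_subset`;
* `image_support_ker_subset_not_isGenericPoint` — the image of the centre in `P` avoids the generic points of a set `Y`
  inside the special fibre as soon as `σ (s s₀)` does (the generic point of the section lies over the generic fibre);
* `natChain_section_step` — ONE E1-STEP: if `(X₁, σ₁, Y₁)` lies in the E1-inductive closure of `(P, 𝟙, Y)`, `s` is a section
  of `σ₁ ≫ q` with `s(s₀) ∈ Y₁` and `σ₁ (s s₀)` not generic in `Y`, and `τ₁ : X₂ → X₁` is a blow-up along `ker s`, then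
  `(X₂, τ₁ ≫ σ₁, closure (τ₁⁻¹(Y₁ ∖ supp ker s)))` lies in the closure too (the E1 analogue of `horizChain_section_step`);
* `chain_of_natChain` — an E1-chain is a `Split.Chain` (a predicate closed under ALL regular-centre steps is closed under the
  fewer E1-steps), so every consequence of `Split.Chain` in the tree (`Chain.fibre`, `chain_isRegular`,
  `closure_subset_preimage_of_chain`, …) applies to E1-chains;
* `natChain_comp` — E1-chains compose (as `Split.Chain.comp`): a chain over `(P, Y)` w.r.t. `q` followed by a chain over
  `(P₁, closure S₁)` w.r.t. `σ₁ ≫ q` is a chain over `(P, Y)` w.r.t. `q`.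

All statements are INLINE in the item's vocabulary (no new definition), so they apply by `exact` to any local abbreviation
of the E1 closure predicate a rung file may introduce.
-/

set_option linter.dupNamespace false -- mandated namespace `Summit.<Summit>.<Problem>` of this single-conjunct summit
set_option linter.overlappingInstances false -- signatures carry `[IsDomain O] [IsDiscreteValuationRing O]`

noncomputable section

open CategoryTheory CategoryTheory.Limits AlgebraicGeometry TopologicalSpace Topology
open Literature.AlgebraicGeometry.Resolution
open Summit.ResolutionOfSingularities.ResolutionOfSingularities.Theses.EquisingularLift.Split
open Summit.ResolutionOfSingularities.ResolutionOfSingularities.Cruxes.EquisingularLift.StrataSplit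

namespace Summit.ResolutionOfSingularities.ResolutionOfSingularities.Cruxes.EquisingularLiftNat.Sections

/-! ## Sections meet the special fibre in one point -/

/-- For a section `s` of `r : X → Spec O` (`O` local), `s(Spec O)` meets the special fibre `r⁻¹{s₀}` exactly in `s(s₀)`.
[folklore] -/
theorem range_inter_preimage_closedPoint_of_section {O : Type} [CommRing O] [IsLocalRing O] {X : Scheme.{0}}
    (r : X ⟶ Spec (.of O)) (s : Spec (.of O) ⟶ X) (hs : s ≫ r = 𝟙 _) :
    Set.range s ∩ r ⁻¹' {IsLocalRing.closedPoint O} = {s (IsLocalRing.closedPoint O)} := by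
  have hrs : ∀ t : Spec (.of O), r (s t) = t := fun t => by
    rw [← Scheme.Hom.comp_apply, hs]; rfl
  ext x
  simp only [Set.mem_inter_iff, Set.mem_range, Set.mem_preimage, Set.mem_singleton_iff]
  constructor
  · rintro ⟨⟨t, rfl⟩, ht⟩
    rw [hrs] at ht
    rw [ht]
  · rintro rfl
    exact ⟨⟨_, rfl⟩, hrs _⟩

/-- For a DVR `O`, a separated `r : X → Spec O` and a section `s` of `r`: the support of the centre `ker s` meets the special
fibre exactly in `s(s₀)` (`supp (ker s) = range s`, tree p167199). [folklore] -/
theorem support_ker_inter_preimage_closedPoint_of_section (O : Type) [CommRing O] [IsDomain O]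
    [IsDiscreteValuationRing O] {X : Scheme.{0}} (r : X ⟶ Spec (.of O)) [IsSeparated r] (s : Spec (.of O) ⟶ X)
    (hs : s ≫ r = 𝟙 _) :
    (s.ker.support : Set X) ∩ r ⁻¹' {IsLocalRing.closedPoint O} = {s (IsLocalRing.closedPoint O)} := by
  obtain ⟨-, -, -, hsupp⟩ := section_isClosedImmersion_and_isRegular_ker O X r s hs
  rw [hsupp]
  exact range_inter_preimage_closedPoint_of_section r s hs

/-- **E1 for section centres.** For a DVR `O`, a separated `r : X → Spec O`, a section `s` of `r` and any set `Y' ∋ s(s₀)`: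
the special points of the centre `ker s` lie in `Y'`. [folklore] -/
theorem support_ker_inter_preimage_closedPoint_subset (O : Type) [CommRing O] [IsDomain O]
    [IsDiscreteValuationRing O] {X : Scheme.{0}} (r : X ⟶ Spec (.of O)) [IsSeparated r] (s : Spec (.of O) ⟶ X)
    (hs : s ≫ r = 𝟙 _) {Y' : Set X} (hY' : s (IsLocalRing.closedPoint O) ∈ Y') :
    (s.ker.support : Set X) ∩ r ⁻¹' {IsLocalRing.closedPoint O} ⊆ Y' := by
  rw [support_ker_inter_preimage_closedPoint_of_section O r s hs]
  exact Set.singleton_subset_iff.mpr hY'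

/-- **Section centres lie over non-generic points.** Let `O` be a DVR, `σ : X → P`, `q : P → Spec O` with `σ ≫ q` separated,
`Y ⊆ P` inside the special fibre, and `s` a section of `σ ≫ q`. If `σ (s s₀)` is not a generic point of `Y`, then the image
under `σ` of the support of `ker s` contains no generic point of `Y` (the other point `s(η)` of the centre lies over the
generic fibre, hence outside `Y`). [folklore] -/
theorem image_support_ker_subset_not_isGenericPoint (O : Type) [CommRing O] [IsDomain O]
    [IsDiscreteValuationRing O] {P X : Scheme.{0}} (σ : X ⟶ P) (q : P ⟶ Spec (.of O)) [IsSeparated (σ ≫ q)]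
    (Y : Set P) (hY : Y ⊆ q ⁻¹' {IsLocalRing.closedPoint O}) (s : Spec (.of O) ⟶ X) (hs : s ≫ (σ ≫ q) = 𝟙 _)
    (hgen : ¬ IsGenericPoint (σ (s (IsLocalRing.closedPoint O))) Y) :
    σ '' (s.ker.support : Set X) ⊆ {x : P | ¬ IsGenericPoint x Y} := by
  -- adapted from `horizChain_section_step` (Theorems/EquisingularLiftEquisingularLiftHorizChainSectionStep.lean)
  obtain ⟨-, -, -, hsupp⟩ := section_isClosedImmersion_and_isRegular_ker O X (σ ≫ q) s hs
  have hcomp : ∀ t, (σ ≫ q) (s t) = t := fun t => by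
    rw [← Scheme.Hom.comp_apply, hs]; rfl
  rintro _ ⟨y, hy, rfl⟩
  rw [hsupp] at hy
  obtain ⟨t, rfl⟩ := hy
  intro hgp
  have hmem : σ (s t) ∈ Y := hgp.mem
  have hqt : (σ ≫ q) (s t) = IsLocalRing.closedPoint O := by
    have h : q (σ (s t)) = IsLocalRing.closedPoint O := hY hmem
    rw [Scheme.Hom.comp_apply]
    exact h
  have ht : t = IsLocalRing.closedPoint O := (hcomp t).symm.trans hqt
  subst ht
  exact hgen hgp

/-! ## One E1-step along a section -/

/-- **ONE E1-STEP ALONG A SECTION** (the E1 analogue of `horizChain_section_step`). Let `O` be a DVR, `q : P → Spec O`,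
`Y ⊆ P` inside the special fibre, `(X₁, σ₁, Y₁)` in the E1-inductive closure of `(P, 𝟙, Y)` (the item's clause, inlined),
`σ₁ ≫ q` separated, `s` a section of `σ₁ ≫ q` with `s(s₀) ∈ Y₁` and `σ₁ (s s₀)` not a generic point of `Y`, and `τ₁ : X₂ → X₁`
a blow-up along `ker s`. Then `(X₂, τ₁ ≫ σ₁, closure (τ₁⁻¹(Y₁ ∖ supp ker s)))` is in the E1-inductive closure: the centre
`V(ker s) ≅ Spec O` is regular (p167199), lies over non-generic points of `Y`, and its only special point `s(s₀)` lies in `Y₁`.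
[folklore] -/
theorem natChain_section_step : ∀ (O : Type) [CommRing O] [IsDomain O] [IsDiscreteValuationRing O] (P : AlgebraicGeometry.Scheme.{0}) (q : P ⟶ AlgebraicGeometry.Spec (.of O)) (Y : Set P) (X₁ X₂ : AlgebraicGeometry.Scheme.{0}) (σ₁ : X₁ ⟶ P) (Y₁ : Set X₁) (s : AlgebraicGeometry.Spec (.of O) ⟶ X₁) (τ₁ : X₂ ⟶ X₁) [AlgebraicGeometry.IsSeparated (CategoryTheory.CategoryStruct.comp σ₁ q)], Y ⊆ q ⁻¹' {IsLocalRing.closedPoint O} → CategoryTheory.CategoryStruct.comp s (CategoryTheory.CategoryStruct.comp σ₁ q) = CategoryTheory.CategoryStruct.id _ → Literature.AlgebraicGeometry.Resolution.IsBlowup τ₁ s.ker → s (IsLocalRing.closedPoint O) ∈ Y₁ → ¬ IsGenericPoint (σ₁ (s (IsLocalRing.closedPoint O))) Y → (∀ Q : (∀ X' : AlgebraicGeometry.Scheme.{0}, (X' ⟶ P) → Set X' → Prop), Q P (CategoryTheory.CategoryStruct.id _) Y → (∀ (X' X'' : AlgebraicGeometry.Scheme.{0}) (σ' : X' ⟶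 P) (Y' : Set X') (C : X'.IdealSheafData) (τ : X'' ⟶ X'), Q X' σ' Y' → Literature.AlgebraicGeometry.Resolution.IsBlowup τ C → Literature.AlgebraicGeometry.Resolution.Scheme.IsRegular C.subscheme → σ' '' (C.support : Set X') ⊆ {x | ¬ IsGenericPoint x Y} → (C.support : Set X') ∩ (CategoryTheory.CategoryStruct.comp σ' q) ⁻¹' {IsLocalRing.closedPoint O} ⊆ Y' → Q X'' (CategoryTheory.CategoryStruct.comp τ σ') (closure (τ ⁻¹' (Y' \ (C.support : Set X'))))) → Q X₁ σ₁ Y₁) → (∀ Q : (∀ X' : AlgebraicGeometry.Scheme.{0}, (X' ⟶ P) → Set X' → Prop), Q P (CategoryTheory.CategoryStruct.id _) Y → (∀ (X' X'' : AlgebraicGeometry.Scheme.{0}) (σ' : X' ⟶ P) (Y' : Set X') (C : X'.IdealSheafData) (τ : X'' ⟶ X'), Q X' σ' Y' → Literature.AlgebraicGeometry.Resolution.IsBlowup τ C → Literature.AlgebraicGeometry.Resolution.Scheme.IsRegular C.subscheme → σ' '' (C.support : Set X') ⊆ {x | ¬ IsGenericPoint x Y} → (C.support : Set X') ∩ (CategoryTheory.CategoryStruct.comp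 σ' q) ⁻¹' {IsLocalRing.closedPoint O} ⊆ Y' → Q X'' (CategoryTheory.CategoryStruct.comp τ σ') (closure (τ ⁻¹' (Y' \ (C.support : Set X'))))) → Q X₂ (CategoryTheory.CategoryStruct.comp τ₁ σ₁) (closure (τ₁ ⁻¹' (Y₁ \ (s.ker.support : Set X₁))))) := by
  intro O _ _ _ P q Y X₁ X₂ σ₁ Y₁ s τ₁ _ hY hs hτ hsY₁ hgen hH Q h0 hstep
  have hQ₁ : Q X₁ σ₁ Y₁ := hH Q h0 hstep
  obtain ⟨-, hreg, -, -⟩ := section_isClosedImmersion_and_isRegular_ker O X₁ (σ₁ ≫ q) s hs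
  have himg : σ₁ '' (s.ker.support : Set X₁) ⊆ {x : P | ¬ IsGenericPoint x Y} :=
    image_support_ker_subset_not_isGenericPoint O σ₁ q Y hY s hs hgen
  have hE1 : (s.ker.support : Set X₁) ∩ (σ₁ ≫ q) ⁻¹' {IsLocalRing.closedPoint O} ⊆ Y₁ :=
    support_ker_inter_preimage_closedPoint_subset O (σ₁ ≫ q) s hs hsY₁
  exact hstep X₁ X₂ σ₁ Y₁ s.ker τ₁ hQ₁ hτ hreg himg hE1

/-! ## Forgetting E1; composition -/

/-- **An E1-chain is a chain** (`Split.Chain`): a predicate closed under ALL regular-centre steps over non-generic points of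
`Y` is in particular closed under the E1-steps, so the E1-inductive closure is contained in the plain one. Hence every
tree consequence of `Split.Chain` (`Chain.fibre`, `chain_isRegular`, `closure_subset_preimage_of_chain`, …) holds for
E1-chains. [folklore] -/
theorem chain_of_natChain {O : Type} [CommRing O] [IsLocalRing O] {P : AlgebraicGeometry.Scheme.{0}} (q : P ⟶ AlgebraicGeometry.Spec (.of O)) (Y : Set P) {P' : AlgebraicGeometry.Scheme.{0}} (σ : P' ⟶ P) (S' : Set P') (h : ∀ Q : (∀ X' : AlgebraicGeometry.Scheme.{0}, (X' ⟶ P) → Set X' → Prop), Q P (CategoryTheory.CategoryStruct.id _) Y → (∀ (X' X'' : AlgebraicGeometry.Scheme.{0}) (σ' : X' ⟶ P) (Y' : Set X') (C : X'.IdealSheafData) (τ : X'' ⟶ X'), Q X' σ' Y' → Literature.AlgebraicGeometry.Resolution.IsBlowup τ C → Literature.AlgebraicGeometry.Resolution.Scheme.IsRegular C.subscheme → σ' '' (C.support : Set X') ⊆ {x | ¬ IsGenericPoint x Y} → (C.support : Set X') ∩ (CategoryTheory.CategoryStruct.comp σ' q) ⁻¹' {IsLocalRing.closedPoint O} ⊆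 Y' → Q X'' (CategoryTheory.CategoryStruct.comp τ σ') (closure (τ ⁻¹' (Y' \ (C.support : Set X'))))) → Q P' σ S') :
    Chain P Y P' σ S' := by
  intro Q h0 hstep
  exact h Q h0 (fun X' X'' σ' Y' C τ hQ hbl hC hgen _hE1 => hstep X' X'' σ' Y' C τ hQ hbl hC hgen)

/-- **E1-chains compose** (as `Split.Chain.comp`). Let `Y = closure {ξ}`. An E1-chain `(P₁, σ₁, S₁)` over `(P, Y)` w.r.t.
`q`, followed by an E1-chain `(P₂, σ₂, S₂)` over `(P₁, closure S₁)` w.r.t. `σ₁ ≫ q`, is an E1-chain `(P₂, σ₂ ≫ σ₁, S₂)` over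
`(P, Y)` w.r.t. `q`: a centre off the generic point `ξ₁` of `closure S₁` is off `ξ` (the fibre of `σ₁` over `ξ` is `{ξ₁}`,
`Chain.fibre`), and the E1 clause is the same up to reassociating `(τ ≫ σ₁) ≫ q = τ ≫ (σ₁ ≫ q)`. [folklore] -/
theorem natChain_comp {O : Type} [CommRing O] [IsLocalRing O] {P : AlgebraicGeometry.Scheme.{0}} (q : P ⟶ AlgebraicGeometry.Spec (.of O)) {Y : Set P} {ξ : P} (hξ : IsGenericPoint ξ Y) {P₁ : AlgebraicGeometry.Scheme.{0}} {σ₁ : P₁ ⟶ P} {S₁ : Set P₁} (h₁ : ∀ Q : (∀ X' : AlgebraicGeometry.Scheme.{0}, (X' ⟶ P) → Set X' → Prop), Q P (CategoryTheory.CategoryStruct.id _) Y → (∀ (X' X'' : AlgebraicGeometry.Scheme.{0}) (σ' : X' ⟶ P) (Y' : Set X') (C : X'.IdealSheafData) (τ : X'' ⟶ X'), Q X' σ' Y' → Literature.AlgebraicGeometry.Resolution.IsBlowup τ C → Literature.AlgebraicGeometry.Resolution.Scheme.IsRegular C.subscheme → σ' '' (C.support : Set X') ⊆ {x | ¬ IsGenericPoint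 x Y} → (C.support : Set X') ∩ (CategoryTheory.CategoryStruct.comp σ' q) ⁻¹' {IsLocalRing.closedPoint O} ⊆ Y' → Q X'' (CategoryTheory.CategoryStruct.comp τ σ') (closure (τ ⁻¹' (Y' \ (C.support : Set X'))))) → Q P₁ σ₁ S₁) {P₂ : AlgebraicGeometry.Scheme.{0}} {σ₂ : P₂ ⟶ P₁} {S₂ : Set P₂} (h₂ : ∀ Q : (∀ X' : AlgebraicGeometry.Scheme.{0}, (X' ⟶ P₁) → Set X' → Prop), Q P₁ (CategoryTheory.CategoryStruct.id _) (closure S₁) → (∀ (X' X'' : AlgebraicGeometry.Scheme.{0}) (σ' : X' ⟶ P₁) (Y' : Set X') (C : X'.IdealSheafData) (τ : X'' ⟶ X'), Q X' σ' Y' → Literature.AlgebraicGeometry.Resolution.IsBlowup τ C → Literature.AlgebraicGeometry.Resolution.Scheme.IsRegular C.subscheme → σ' '' (C.support : Set X') ⊆ {x | ¬ IsGenericPoint x (closure S₁)} → (C.support : Set X') ∩ (CategoryTheory.CategoryStruct.comp σ' (CategoryTheory.CategoryStruct.comp σ₁ q)) ⁻¹' {IsLocalRing.closedPoint O} ⊆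 Y' → Q X'' (CategoryTheory.CategoryStruct.comp τ σ') (closure (τ ⁻¹' (Y' \ (C.support : Set X'))))) → Q P₂ σ₂ S₂) :
    ∀ Q : (∀ X' : AlgebraicGeometry.Scheme.{0}, (X' ⟶ P) → Set X' → Prop), Q P (CategoryTheory.CategoryStruct.id _) Y → (∀ (X' X'' : AlgebraicGeometry.Scheme.{0}) (σ' : X' ⟶ P) (Y' : Set X') (C : X'.IdealSheafData) (τ : X'' ⟶ X'), Q X' σ' Y' → Literature.AlgebraicGeometry.Resolution.IsBlowup τ C → Literature.AlgebraicGeometry.Resolution.Scheme.IsRegular C.subscheme → σ' '' (C.support : Set X') ⊆ {x | ¬ IsGenericPoint x Y} → (C.support : Set X') ∩ (CategoryTheory.CategoryStruct.comp σ' q) ⁻¹' {IsLocalRing.closedPoint O} ⊆ Y' → Q X'' (CategoryTheory.CategoryStruct.comp τ σ') (closure (τ ⁻¹' (Y' \ (C.support : Set X'))))) → Q P₂ (CategoryTheory.CategoryStruct.comp σ₂ σ₁) S₂ := by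
  -- adapted from `Split.Chain.comp` (Theorems/EquisingularLiftEquisingularLiftSplit.lean)
  obtain ⟨ξ₁, hfib, hS₁⟩ := (chain_of_natChain q Y σ₁ S₁ h₁).fibre hξ
  have hS₁cl : closure S₁ = S₁ := by rw [hS₁, closure_closure]
  have hgen₁ : IsGenericPoint ξ₁ (closure S₁) := by
    rw [isGenericPoint_def, hS₁, closure_closure]
  intro Q hbase hstep
  have hQ₁ : Q P₁ σ₁ S₁ := h₁ Q hbase hstep
  refine h₂ (fun X' τ T => Q X' (CategoryStruct.comp τ σ₁) T) ?_ ?_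
  · simpa [hS₁cl] using hQ₁
  · intro X' X'' τ T C τ' hQ hτ' hC hTC hE1
    have key : (CategoryStruct.comp τ σ₁) '' (C.support : Set X') ⊆ {x : P | ¬ IsGenericPoint x Y} := by
      rintro _ ⟨c, hc, rfl⟩ hgen
      have h1 : σ₁ (τ c) = ξ := by
        rw [← Scheme.Hom.comp_apply]
        exact hgen.eq hξ
      have h2 : τ c = ξ₁ := by
        have : τ c ∈ σ₁ ⁻¹' {ξ} := h1
        rw [hfib] at this
        simpa using this
      exact hTC ⟨c, hc, rfl⟩ (h2 ▸ hgen₁)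
    have hE1' : (C.support : Set X') ∩ (CategoryStruct.comp (CategoryStruct.comp τ σ₁) q) ⁻¹'
        {IsLocalRing.closedPoint O} ⊆ T := by
      rw [Category.assoc]; exact hE1
    have := hstep X' X'' (CategoryStruct.comp τ σ₁) T C τ' hQ hτ' hC key hE1'
    simpa [Category.assoc] using this

end Summit.ResolutionOfSingularities.ResolutionOfSingularities.Cruxes.EquisingularLiftNat.Sections

end
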